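import Summits.HubbardSuperconductivity.HubbardSuperconductivity.Theses.CooperPairDMottWalk
import Literature.MathematicalPhysics.QuantumLattice.PairFieldSelectionRule

/-!
# Route `CooperPairDMottWalk`, crux `BindingWalk` (stmt-HubbardSuperconductivity-1176):
# the quantum numbers the Cooper-pair package forces at the pure point

Helper file (`--supports stmt-HubbardSuperconductivity-1176`) for the registered line
`Cruxes/BindingWalk/Lines/birth.lean`, stub `stub_dWaveSelection` (S3: at the pure torus, uniform
two-hole binding ⇒ the full package). The route's Cooper-pair package `CP L H ε z` is
(a) two-hole pair binding with margin `ε`, (b) uniqueness up to phase of the `(L²-2, S^z=0)`-sector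
ground state `φ₂`, (c) the `d_{x²-y²}` amplitude bound
`z L² ‖φ₀‖² ‖φ₂‖² ≤ |⟨φ₂, Δ_d φ₀⟩|²` against every half-filled sector ground state `φ₀`.
This file proves what (b)∧(c) with `z > 0` FORCE on the two floors of the pure torus
`hubbardTorus 2 L t U` — the necessary conditions S3 has to produce and a disprover can attack:

* `groundStates_smul_of_amplitude_lower_bound` — (abstract) a uniform lower bound
  `c ‖φ₀‖² ≤ |⟨φ₂, Δ φ₀⟩|²`, `c > 0`, over the ground states `φ₀` of a sector forces that sector's
  ground space to be ONE-dimensional (a linear functional with no kernel on a subspace);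
* `halfFilled_groundStates_smul_of_cooperPackage` — hence clause (c) alone (with one two-hole
  ground state in existence) makes the HALF-FILLED `(L², 0)` floor non-degenerate: the package
  silently contains the conclusion of Lieb's second theorem for the even torus;
* `cooperPackage_spaceGroup_eigen` (registered sub-goal stub; binder form `cooperPackage_spaceGroup_eigen'`) — for the pure torus, every space-group unitary
  `U_g = U_γ U_v` (`fockD4 γ * fockTranslate v`) acts on the two floors by scalars `lam` (on `φ₀`)
  and `χ_{B₁g}(γ) · lam` (on `φ₂`): equal lattice momentum (`γ = 1`,
  `cooperPackage_sameMomentum`) and `B₁g`-twisted point-group characters (`v = 0`; for the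
  rotation by `π/2`, `cooperPackage_rotation_eigen`: opposite `C₄` eigenvalues) — Wigner's selection
  rule (`pairField_dWave_matrixElement_eq_zero` in the tree) run backwards from the non-vanishing
  amplitude of clause (c);
* `pureCooperPair_spaceGroup_eigen` — the same read off the route's target `PureCooperPair`
  by name: eventually in `k`, on the tori of side `4k+4`.

References: D. J. Scalapino, Phys. Rep. 250 (1995) 329, §2 (the `d_{x²-y²}` pair field and its
`B₁g` covariance); E. P. Wigner, *Group Theory* (1959), ch. 12 (selection rules); E. H. Lieb,
PRL 62 (1989) 1201, Theorem 2 (uniqueness of the half-filled ground state, here a CONSEQUENCE of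
the package rather than an input). Elementary linear algebra over tree definitions; no definition
and no named fact is introduced.
-/

set_option linter.dupNamespace false

noncomputable section

namespace Summit.HubbardSuperconductivity.HubbardSuperconductivity.Theorems.CooperPairDMottWalk

open Matrix Finset Literature.MathematicalPhysics.QuantumLattice Literature.Probability.LatticeModels
open scoped ComplexOrder

/-! ### Abstract: a coercive amplitude bound makes a ground space one-dimensional -/

section Generic

variable {Λ : Type*} [LinearOrder Λ] [Fintype Λ]

/-- A nonzero linear combination of two sector ground states (same `H`, same sector) is again a
sector ground state: the sector is a submodule and the eigen-equation is linear. [folklore] -/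
theorem isGroundStateInSector_sub_smul {H : Matrix (Finset (Orb Λ)) (Finset (Orb Λ)) ℂ} {N : ℕ}
    {M : ℝ} {φ φ' : Fock (Orb Λ)} (hφ : IsGroundStateInSector H N M φ)
    (hφ' : IsGroundStateInSector H N M φ') (a a' : ℂ) (hne : a' • φ - a • φ' ≠ 0) :
    IsGroundStateInSector H N M (a' • φ - a • φ') := by
  refine ⟨Submodule.sub_mem _ (Submodule.smul_mem _ _ hφ.1) (Submodule.smul_mem _ _ hφ'.1), hne, ?_⟩
  rw [mulVec_sub, mulVec_smul, mulVec_smul, hφ.2.2, hφ'.2.2, smul_sub, smul_comm a', smul_comm a]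

/-- **A coercive amplitude bound forces a one-dimensional ground space.** If some fixed vector
`φ₂` and operator `Δ` satisfy `c ‖φ₀‖² ≤ |⟨φ₂, Δ φ₀⟩|²` with `c > 0` for EVERY ground state `φ₀`
of `H` in the sector `(N, M)`, then that sector's ground states are proportional: the linear
functional `φ₀ ↦ ⟨φ₂, Δ φ₀⟩` would otherwise vanish on a nonzero ground state. [folklore] -/
theorem groundStates_smul_of_amplitude_lower_bound
    {H Δ : Matrix (Finset (Orb Λ)) (Finset (Orb Λ)) ℂ} {N : ℕ} {M : ℝ} {c : ℝ} (hc : 0 < c)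
    (φ₂ : Fock (Orb Λ))
    (hamp : ∀ φ₀, IsGroundStateInSector H N M φ₀ →
      c * (star φ₀ ⬝ᵥ φ₀).re ≤ ‖star φ₂ ⬝ᵥ (Δ *ᵥ φ₀)‖ ^ 2) :
    ∀ φ₀ φ₀', IsGroundStateInSector H N M φ₀ → IsGroundStateInSector H N M φ₀' →
      ∃ a : ℂ, φ₀' = a • φ₀ := by
  intro φ₀ φ₀' h₀ h₀'
  obtain ⟨a, ha⟩ : ∃ a : ℂ, a = star φ₂ ⬝ᵥ (Δ *ᵥ φ₀) := ⟨_, rfl⟩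
  obtain ⟨a', ha'⟩ : ∃ a' : ℂ, a' = star φ₂ ⬝ᵥ (Δ *ᵥ φ₀') := ⟨_, rfl⟩
  have ha0 : a ≠ 0 := by
    intro h
    have h1 := hamp φ₀ h₀
    rw [← ha, h, norm_zero, zero_pow two_ne_zero] at h1
    have hpos : 0 < (star φ₀ ⬝ᵥ φ₀).re :=
      (Complex.pos_iff.1 (dotProduct_star_self_pos_iff.2 h₀.2.1)).1
    linarith [mul_pos hc hpos]
  -- the combination `a' φ₀ - a φ₀'` has vanishing amplitude, so it is not a ground state: it is `0`
  have hψ : a' • φ₀ - a • φ₀' = 0 := by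
    by_contra hne
    have h1 := hamp _ (isGroundStateInSector_sub_smul h₀ h₀' a a' hne)
    have hzero : star φ₂ ⬝ᵥ (Δ *ᵥ (a' • φ₀ - a • φ₀')) = 0 := by
      rw [mulVec_sub, mulVec_smul, mulVec_smul, dotProduct_sub, dotProduct_smul, dotProduct_smul,
        smul_eq_mul, smul_eq_mul, ← ha, ← ha']
      ring
    rw [hzero, norm_zero, zero_pow two_ne_zero] at h1
    have hpos : 0 < (star (a' • φ₀ - a • φ₀') ⬝ᵥ (a' • φ₀ - a • φ₀')).re :=
      (Complex.pos_iff.1 (dotProduct_star_self_pos_iff.2 hne)).1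
    linarith [mul_pos hc hpos]
  refine ⟨a⁻¹ * a', ?_⟩
  have h : a • φ₀' = a' • φ₀ := (sub_eq_zero.1 hψ).symm
  calc φ₀' = a⁻¹ • (a • φ₀') := by rw [smul_smul, inv_mul_cancel₀ ha0, one_smul]
    _ = (a⁻¹ * a') • φ₀ := by rw [h, smul_smul]

/-- If the ground states of a sector are proportional and `V` maps sector ground states to sector
ground states, then every ground state of the sector is an eigenvector of `V`. [folklore] -/
theorem exists_eigenvalue_of_groundStates_smul {H V : Matrix (Finset (Orb Λ)) (Finset (Orb Λ)) ℂ}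
    {N : ℕ} {M : ℝ}
    (huniq : ∀ φ φ', IsGroundStateInSector H N M φ → IsGroundStateInSector H N M φ' →
      ∃ a : ℂ, φ' = a • φ)
    (hV : ∀ φ, IsGroundStateInSector H N M φ → IsGroundStateInSector H N M (V *ᵥ φ))
    {φ : Fock (Orb Λ)} (hφ : IsGroundStateInSector H N M φ) : ∃ lam : ℂ, V *ᵥ φ = lam • φ :=
  huniq φ (V *ᵥ φ) hφ (hV φ hφ)

end Generic

/-! ### The pure torus: what the package forces on the two floors -/

section Torus

variable {L : ℕ} [NeZero L]

/-- **Clause (c) makes the half-filled floor non-degenerate.** If the `d`-wave amplitude bound of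
the route's package holds with `z > 0` for a Hamiltonian `H` on the torus of side `L`, and the
`(L²-2, 0)` sector has a ground state at all, then the `(L², 0)`-sector ground states of `H` are
proportional. (For `H = hubbardTorus 2 L t U`, `U > 0`, even `L`, this is the uniqueness half of
Lieb's Theorem 2 — obtained here from the package, not assumed.) [folklore] -/
theorem halfFilled_groundStates_smul_of_cooperPackage
    {H : Matrix (Finset (Orb (FermionTorus 2 L))) (Finset (Orb (FermionTorus 2 L))) ℂ} {z : ℝ}
    (hz : 0 < z) {φ₂ : Fock (Orb (FermionTorus 2 L))}
    (h₂ : IsGroundStateInSector H (L ^ 2 - 2) 0 φ₂)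
    (hamp : ∀ φ₀ φ₂, IsGroundStateInSector H (L ^ 2) 0 φ₀ → IsGroundStateInSector H (L ^ 2 - 2) 0 φ₂ →
      z * (L : ℝ) ^ 2 * (star φ₀ ⬝ᵥ φ₀).re * (star φ₂ ⬝ᵥ φ₂).re ≤
        ‖star φ₂ ⬝ᵥ (pairField dWaveFormFactor L *ᵥ φ₀)‖ ^ 2) :
    ∀ φ₀ φ₀', IsGroundStateInSector H (L ^ 2) 0 φ₀ → IsGroundStateInSector H (L ^ 2) 0 φ₀' →
      ∃ a : ℂ, φ₀' = a • φ₀ := by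
  have hL : (0 : ℝ) < (L : ℝ) ^ 2 := by
    have : (0 : ℝ) < L := Nat.cast_pos.2 (Nat.pos_of_ne_zero (NeZero.ne L))
    positivity
  have h2pos : 0 < (star φ₂ ⬝ᵥ φ₂).re :=
    (Complex.pos_iff.1 (dotProduct_star_self_pos_iff.2 h₂.2.1)).1
  have hc : 0 < z * (L : ℝ) ^ 2 * (star φ₂ ⬝ᵥ φ₂).re := by positivity
  refine groundStates_smul_of_amplitude_lower_bound (Δ := pairField dWaveFormFactor L) hc φ₂
    fun φ₀ hφ₀ => ?_
  calc z * (L : ℝ) ^ 2 * (star φ₂ ⬝ᵥ φ₂).re * (star φ₀ ⬝ᵥ φ₀).re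
      = z * (L : ℝ) ^ 2 * (star φ₀ ⬝ᵥ φ₀).re * (star φ₂ ⬝ᵥ φ₂).re := by ring
    _ ≤ ‖star φ₂ ⬝ᵥ (pairField dWaveFormFactor L *ᵥ φ₀)‖ ^ 2 := hamp φ₀ φ₂ hφ₀ h₂

/-- **The package forces the space-group quantum numbers of both floors.** Let the route's
Cooper-pair package (a)∧(b)∧(c) hold with `z > 0` for the pure torus `hubbardTorus 2 L t U`
(written out verbatim: the route's `let CP`). Then for every space-group element `g = (γ, v)`,
realised by the unitary `U_g = fockD4 γ * fockTranslate v`, every half-filled sector ground state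
`φ₀` and every two-hole sector ground state `φ₂` are `U_g`-eigenvectors, with eigenvalues `lam`
and `χ_{B₁g}(γ) · lam`: the two floors carry the SAME lattice momentum and `B₁g`-twisted `D₄`
characters. Proof: (c) ⇒ `φ₀` unique (previous theorem) and (b) ⇒ `φ₂` unique, `U_g` transports
sector ground states (`IsGroundStateInSector.spaceGroup_mulVec`), so both are eigenvectors; the
amplitude `⟨φ₂, Δ_d φ₀⟩ ≠ 0` by (c), and `U_g Δ_d = χ_{B₁g}(γ) Δ_d U_g`
(`spaceGroup_mul_pairField_dWave`) leaves no other eigenvalue ratio (Wigner).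
[cite: Scalapino1995, §2 eq. (2.3)] -/
theorem cooperPackage_spaceGroup_eigen' (t U : ℝ) {ε z : ℝ} (hz : 0 < z)
    (hCP : (hubbardTorus 2 L t U).minEnergyOn (szSector (L ^ 2 - 2) 0) +
          (hubbardTorus 2 L t U).minEnergyOn (szSector (L ^ 2) 0) + ε ≤
        2 * (hubbardTorus 2 L t U).minEnergyOn (szSector (L ^ 2 - 1) (1 / 2)) ∧
      (∀ φ₁ φ₂, IsGroundStateInSector (hubbardTorus 2 L t U) (L ^ 2 - 2) 0 φ₁ →
        IsGroundStateInSector (hubbardTorus 2 L t U) (L ^ 2 - 2) 0 φ₂ → ∃ c : ℂ, φ₂ = c • φ₁) ∧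
      (∀ φ₀ φ₂, IsGroundStateInSector (hubbardTorus 2 L t U) (L ^ 2) 0 φ₀ →
        IsGroundStateInSector (hubbardTorus 2 L t U) (L ^ 2 - 2) 0 φ₂ →
          z * (L : ℝ) ^ 2 * (star φ₀ ⬝ᵥ φ₀).re * (star φ₂ ⬝ᵥ φ₂).re ≤
            ‖star φ₂ ⬝ᵥ (pairField dWaveFormFactor L *ᵥ φ₀)‖ ^ 2))
    (γ : DihedralGroup 4) (v : TorusSite 2 L) {φ₀ φ₂ : Fock (Orb (FermionTorus 2 L))}
    (h₀ : IsGroundStateInSector (hubbardTorus 2 L t U) (L ^ 2) 0 φ₀)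
    (h₂ : IsGroundStateInSector (hubbardTorus 2 L t U) (L ^ 2 - 2) 0 φ₂) :
    ∃ lam : ℂ, ((fockD4 (L := L) γ).val * (fockTranslate v).val) *ᵥ φ₀ = lam • φ₀ ∧
      ((fockD4 (L := L) γ).val * (fockTranslate v).val) *ᵥ φ₂ = (b1gChar γ * lam) • φ₂ := by
  obtain ⟨-, huniq₂, hamp⟩ := hCP
  -- both floors are one-dimensional, and `U_g` transports sector ground states: eigenvectors
  have huniq₀ := halfFilled_groundStates_smul_of_cooperPackage hz h₂ hamp
  have hV : ∀ (N : ℕ) (M : ℝ) (φ : Fock (Orb (FermionTorus 2 L))),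
      IsGroundStateInSector (hubbardTorus 2 L t U) N M φ →
        IsGroundStateInSector (hubbardTorus 2 L t U) N M
          (((fockD4 (L := L) γ).val * (fockTranslate v).val) *ᵥ φ) :=
    fun N M φ hφ => hφ.spaceGroup_mulVec γ v t U
  obtain ⟨lam, hlam⟩ := exists_eigenvalue_of_groundStates_smul huniq₀ (hV _ _) h₀
  obtain ⟨mu, hmu⟩ := exists_eigenvalue_of_groundStates_smul huniq₂ (hV _ _) h₂
  refine ⟨lam, hlam, ?_⟩
  have hiso := star_spaceGroup_mulVec_dotProduct (L := L) γ v
  -- `|mu| = 1`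
  have hmumu : star mu * mu = 1 := by
    have h := hiso φ₂ φ₂
    rw [hmu, star_smul, smul_dotProduct, dotProduct_smul, smul_smul, smul_eq_mul] at h
    have hne : star φ₂ ⬝ᵥ φ₂ ≠ 0 := (dotProduct_star_self_pos_iff.2 h₂.2.1).ne'
    exact mul_right_cancel₀ hne (h.trans (one_mul _).symm)
  -- the amplitude of clause (c) is nonzero
  have hamp0 : star φ₂ ⬝ᵥ (pairField dWaveFormFactor L *ᵥ φ₀) ≠ 0 := by
    intro h
    have h1 := hamp φ₀ φ₂ h₀ h₂
    rw [h, norm_zero, zero_pow two_ne_zero] at h1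
    have hL : (0 : ℝ) < (L : ℝ) ^ 2 := by
      have : (0 : ℝ) < L := Nat.cast_pos.2 (Nat.pos_of_ne_zero (NeZero.ne L))
      positivity
    have hpos₀ : 0 < (star φ₀ ⬝ᵥ φ₀).re :=
      (Complex.pos_iff.1 (dotProduct_star_self_pos_iff.2 h₀.2.1)).1
    have hpos₂ : 0 < (star φ₂ ⬝ᵥ φ₂).re :=
      (Complex.pos_iff.1 (dotProduct_star_self_pos_iff.2 h₂.2.1)).1
    have : 0 < z * (L : ℝ) ^ 2 * (star φ₀ ⬝ᵥ φ₀).re * (star φ₂ ⬝ᵥ φ₂).re := by positivity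
    linarith
  -- Wigner: a nonzero amplitude pins the eigenvalue of `φ₂` to `χ(γ) · lam`
  by_contra hne
  have hne' : star mu * b1gChar γ * lam ≠ 1 := by
    intro h1
    apply hne
    rw [hmu]
    congr 1
    calc mu = mu * (star mu * b1gChar γ * lam) := by rw [h1, mul_one]
      _ = (star mu * mu) * (b1gChar γ * lam) := by ring
      _ = b1gChar γ * lam := by rw [hmumu, one_mul]
  exact hamp0 (dotProduct_mulVec_eq_zero_of_twisted_eigen _ (pairField dWaveFormFactor L)
    (b1gChar γ) lam mu φ₀ φ₂ hiso (spaceGroup_mul_pairField_dWave γ v) hlam hmu hne')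

/-- **Equal lattice momentum of the two floors** (`γ = 1`): under the package with `z > 0`, every
translation `U_v` acts on the half-filled and on the two-hole sector ground states of the pure
torus by the SAME phase. [cite: Scalapino1995, §2 eq. (2.2)] -/
theorem cooperPackage_sameMomentum (t U : ℝ) {ε z : ℝ} (hz : 0 < z)
    (hCP : (hubbardTorus 2 L t U).minEnergyOn (szSector (L ^ 2 - 2) 0) +
          (hubbardTorus 2 L t U).minEnergyOn (szSector (L ^ 2) 0) + ε ≤
        2 * (hubbardTorus 2 L t U).minEnergyOn (szSector (L ^ 2 - 1) (1 / 2)) ∧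
      (∀ φ₁ φ₂, IsGroundStateInSector (hubbardTorus 2 L t U) (L ^ 2 - 2) 0 φ₁ →
        IsGroundStateInSector (hubbardTorus 2 L t U) (L ^ 2 - 2) 0 φ₂ → ∃ c : ℂ, φ₂ = c • φ₁) ∧
      (∀ φ₀ φ₂, IsGroundStateInSector (hubbardTorus 2 L t U) (L ^ 2) 0 φ₀ →
        IsGroundStateInSector (hubbardTorus 2 L t U) (L ^ 2 - 2) 0 φ₂ →
          z * (L : ℝ) ^ 2 * (star φ₀ ⬝ᵥ φ₀).re * (star φ₂ ⬝ᵥ φ₂).re ≤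
            ‖star φ₂ ⬝ᵥ (pairField dWaveFormFactor L *ᵥ φ₀)‖ ^ 2))
    (v : TorusSite 2 L) {φ₀ φ₂ : Fock (Orb (FermionTorus 2 L))}
    (h₀ : IsGroundStateInSector (hubbardTorus 2 L t U) (L ^ 2) 0 φ₀)
    (h₂ : IsGroundStateInSector (hubbardTorus 2 L t U) (L ^ 2 - 2) 0 φ₂) :
    ∃ lam : ℂ, ((fockD4 (L := L) 1).val * (fockTranslate v).val) *ᵥ φ₀ = lam • φ₀ ∧
      ((fockD4 (L := L) 1).val * (fockTranslate v).val) *ᵥ φ₂ = lam • φ₂ := by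
  obtain ⟨lam, hl0, hl2⟩ := cooperPackage_spaceGroup_eigen' t U hz hCP 1 v h₀ h₂
  exact ⟨lam, hl0, by rwa [b1gChar_one, one_mul] at hl2⟩

/-- **Opposite `C₄` characters of the two floors** (`γ = r 1`, `v = 0`): under the package with
`z > 0`, the rotation by `π/2` of the pure torus acts on the half-filled ground state by `lam` and
on the two-hole ground state by `-lam` — the pair is `d_{x²-y²}` RELATIVE to the parent.
[cite: Scalapino1995, §2 eq. (2.3)] -/
theorem cooperPackage_rotation_eigen (t U : ℝ) {ε z : ℝ} (hz : 0 < z)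
    (hCP : (hubbardTorus 2 L t U).minEnergyOn (szSector (L ^ 2 - 2) 0) +
          (hubbardTorus 2 L t U).minEnergyOn (szSector (L ^ 2) 0) + ε ≤
        2 * (hubbardTorus 2 L t U).minEnergyOn (szSector (L ^ 2 - 1) (1 / 2)) ∧
      (∀ φ₁ φ₂, IsGroundStateInSector (hubbardTorus 2 L t U) (L ^ 2 - 2) 0 φ₁ →
        IsGroundStateInSector (hubbardTorus 2 L t U) (L ^ 2 - 2) 0 φ₂ → ∃ c : ℂ, φ₂ = c • φ₁) ∧
      (∀ φ₀ φ₂, IsGroundStateInSector (hubbardTorus 2 L t U) (L ^ 2) 0 φ₀ →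
        IsGroundStateInSector (hubbardTorus 2 L t U) (L ^ 2 - 2) 0 φ₂ →
          z * (L : ℝ) ^ 2 * (star φ₀ ⬝ᵥ φ₀).re * (star φ₂ ⬝ᵥ φ₂).re ≤
            ‖star φ₂ ⬝ᵥ (pairField dWaveFormFactor L *ᵥ φ₀)‖ ^ 2))
    {φ₀ φ₂ : Fock (Orb (FermionTorus 2 L))}
    (h₀ : IsGroundStateInSector (hubbardTorus 2 L t U) (L ^ 2) 0 φ₀)
    (h₂ : IsGroundStateInSector (hubbardTorus 2 L t U) (L ^ 2 - 2) 0 φ₂) :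
    ∃ lam : ℂ,
      ((fockD4 (L := L) (DihedralGroup.r 1)).val * (fockTranslate (0 : TorusSite 2 L)).val) *ᵥ φ₀ =
          lam • φ₀ ∧
        ((fockD4 (L := L) (DihedralGroup.r 1)).val * (fockTranslate (0 : TorusSite 2 L)).val) *ᵥ φ₂ =
          (-lam) • φ₂ := by
  obtain ⟨lam, hl0, hl2⟩ := cooperPackage_spaceGroup_eigen' t U hz hCP (DihedralGroup.r 1) 0 h₀ h₂
  -- `χ_{B₁g}(r) = -1` (also landed as `CapRgSymmetricCertificatePinned.Negative.b1gChar_r_one`; inlined to keep imports light)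
  have hχ : b1gChar (DihedralGroup.r 1) = -1 := by
    show (-1 : ℂ) ^ (1 : ZMod 4).val = -1
    rw [show (1 : ZMod 4).val = 1 from rfl, pow_one]
  exact ⟨lam, hl0, by rwa [hχ, neg_one_mul] at hl2⟩

/-- **Read off the route's target by name.** If `PureCooperPair` holds, then for the `U`, `z` and
`k₀` it provides, on every torus of side `L = 4k+4`, `k ≥ k₀`, each space-group unitary acts on the
half-filled and two-hole sector ground states of `hubbardTorus 2 L 1 U` by `lam` and
`χ_{B₁g}(γ) · lam`. [cite: Scalapino1995, §2 eq. (2.3)] -/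
theorem pureCooperPair_spaceGroup_eigen
    (h : Summit.HubbardSuperconductivity.HubbardSuperconductivity.Theses.CooperPairDMottWalk.PureCooperPair) :
    ∃ U ∈ Set.Icc (2 : ℝ) 8, ∃ k₀ : ℕ, ∀ k ≥ k₀, ∀ (γ : DihedralGroup 4) (v : TorusSite 2 (4 * k + 4))
      (φ₀ φ₂ : Fock (Orb (FermionTorus 2 (4 * k + 4)))),
      IsGroundStateInSector (hubbardTorus 2 (4 * k + 4) 1 U) ((4 * k + 4) ^ 2) 0 φ₀ →
      IsGroundStateInSector (hubbardTorus 2 (4 * k + 4) 1 U) ((4 * k + 4) ^ 2 - 2) 0 φ₂ →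
        ∃ lam : ℂ,
          ((fockD4 (L := 4 * k + 4) γ).val * (fockTranslate v).val) *ᵥ φ₀ = lam • φ₀ ∧
            ((fockD4 (L := 4 * k + 4) γ).val * (fockTranslate v).val) *ᵥ φ₂ =
              (b1gChar γ * lam) • φ₂ := by
  obtain ⟨U, hU, ε, -, z, hz, k₀, hK⟩ := h
  refine ⟨U, hU, k₀, fun k hk γ v φ₀ φ₂ h₀ h₂ => ?_⟩
  exact cooperPackage_spaceGroup_eigen' (L := 4 * k + 4) 1 U hz (hK k hk) γ v h₀ h₂

end Torus

/-! ### The registered sub-goal stub (verbatim signature) -/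

/-- **Registered sub-goal stub `cooperPackage_spaceGroup_eigen`** of the line `registered` for the
crux `BindingWalk` (helper for `stub_dWaveSelection`): the Cooper-pair package with `z > 0` at the
pure torus makes every half-filled / two-hole sector ground state an eigenvector of every
space-group unitary, with eigenvalues `lam` / `χ_{B₁g}(γ) · lam`. (`cooperPackage_spaceGroup_eigen'`
in binder form.) [cite: Scalapino1995, §2 eq. (2.3)] -/
theorem cooperPackage_spaceGroup_eigen : ∀ {L : ℕ} [NeZero L] (t U : ℝ) {ε z : ℝ}, 0 < z → ((hubbardTorus 2 L t U).minEnergyOn (szSector (L ^ 2 - 2) 0) + (hubbardTorus 2 L t U).minEnergyOn (szSector (L ^ 2) 0) + ε ≤ 2 * (hubbardTorus 2 L t U).minEnergyOn (szSector (L ^ 2 - 1) (1 / 2)) ∧ (∀ φ₁ φ₂, IsGroundStateInSector (hubbardTorus 2 L t U) (L ^ 2 - 2) 0 φ₁ → IsGroundStateInSector (hubbardTorus 2 L t U) (L ^ 2 - 2) 0 φ₂ → ∃ c : ℂ, φ₂ = c • φ₁) ∧ (∀ φ₀ φ₂, IsGroundStateInSector (hubbardTorus 2 L t U) (L ^ 2)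 0 φ₀ → IsGroundStateInSector (hubbardTorus 2 L t U) (L ^ 2 - 2) 0 φ₂ → z * (L : ℝ) ^ 2 * (star φ₀ ⬝ᵥ φ₀).re * (star φ₂ ⬝ᵥ φ₂).re ≤ ‖star φ₂ ⬝ᵥ (pairField dWaveFormFactor L *ᵥ φ₀)‖ ^ 2)) → ∀ (γ : DihedralGroup 4) (v : TorusSite 2 L) {φ₀ φ₂ : Fock (Orb (FermionTorus 2 L))}, IsGroundStateInSector (hubbardTorus 2 L t U) (L ^ 2) 0 φ₀ → IsGroundStateInSector (hubbardTorus 2 L t U) (L ^ 2 - 2) 0 φ₂ → ∃ lam : ℂ, ((fockD4 (L := L) γ).val * (fockTranslate v).val) *ᵥ φ₀ = lam • φ₀ ∧ ((fockD4 (L := L) γ).val * (fockTranslate v).val) *ᵥ φ₂ = (b1gChar γ * lam) • φ₂ :=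
  @fun _ _ t U _ _ hz hCP γ v _ _ h₀ h₂ => cooperPackage_spaceGroup_eigen' t U hz hCP γ v h₀ h₂

end Summit.HubbardSuperconductivity.HubbardSuperconductivity.Theorems.CooperPairDMottWalk

end
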